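import Summits.AtomisticToContinuum.HydrodynamicLimit.Theses.JParityClosure
import HarnessLib

/-!
# Detailed balance of a J-symmetric Metropolis-reweighted collision record
(stub `stub_detailedBalanceOfSymmetricRecord`)

Helper for the line `Sketch` of the crux `JParityClosure.ParityBandClosure`
(stmt-AtomisticToContinuum-17608), sub-goal of the skeleton stubs `stub_maxwellDefectVanishes` /
`stub_isotropyOfMaxwellDefect`.

WHAT. Let `κ` be a finite measure on the collision-record space `(V3 × V3) × S²` (pre-collisional
pair and impact direction), `F` a measurable real function on it (the surprisal jump), and
`J q = (collide q.2 q.1, −q.2)` the inverse-collision map. ASSUME: `F ∘ J = −F`; the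
Metropolis-reweighted record `ν := min(1, e^{−F}) · κ` is `J`-invariant (`ν.map J = ν`); `F` is
`κ`-integrable with `∫ F dκ = 0` (free collisional balance); and `π ≪ κ`. THEN `F = 0` holds
`π`-almost everywhere (detailed balance).

PROOF. (1) The Metropolis density `d = min(1, e^{−F}) ∈ (0, 1]` has the pointwise inverse
`m = max(1, e^{F})`, `d · m = 1` (`min_one_exp_neg_mul_max_one_exp`), so `κ = m · ν`
(`withDensity_mul`, `withDensity_one`) and in particular `κ ≪ ν`. (2) Hence
`∫ F dκ = ∫ m F dν` and `m F` is `ν`-integrable (`integral_withDensity_eq_integral_toReal_smul`,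
`integrable_withDensity_iff_integrable_smul'`). (3) By `J`-invariance of `ν` and oddness of `F`,
`∫ m F dν = ∫ (m F) ∘ J dν = −∫ max(1, e^{−F}) F dν` (`integral_map`). Adding,
`2 ∫ F dκ = ∫ φ(F) dν` with `φ(x) = x (max(1, eˣ) − max(1, e^{−x})) = |x| (e^{|x|} − 1) ≥ 0`,
vanishing only at `x = 0` (`phi_nonneg`, `phi_eq_zero_iff`). (4) So `∫ F dκ = 0` forces
`φ(F) = 0` `ν`-a.e. (`integral_eq_zero_iff_of_nonneg`), i.e. `F = 0` `ν`-a.e., hence `κ`-a.e.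
(`κ ≪ ν`), hence `π`-a.e. (`π ≪ κ`). The measure-theoretic core is
`ae_eq_zero_of_odd_of_map_withDensity_eq` (abstract measurable space, measurable `J`); the only
input about `collide` is the continuity of `J` (`continuous_inverseCollision`).

REFERENCES. C. Cercignani, R. Illner, M. Pulvirenti, *The Mathematical Theory of Dilute Gases*,
1994, §3.1–3.2 (micro-reversibility `(v, w, n̂) ↦ (v′, w′, −n̂)` and the equality case of the
H-theorem); W. K. Hastings, *Monte Carlo sampling methods using Markov chains and their
applications*, Biometrika 57 (1970) (the acceptance `min(1, e^{−F})`).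
-/

noncomputable section

namespace Summit.AtomisticToContinuum.HydrodynamicLimit.Theorems.ParityBandClosureDetailedBalance

open scoped BigOperators ENNReal
open MeasureTheory
open Literature.MathematicalPhysics.KineticTheory Literature.Analysis.FluidPDE

/-! ## §1 Scalar facts about the Metropolis density `min(1, e^{−x})` -/

/-- The Metropolis density is positive: `0 < min(1, e^{−x})`. [folklore] -/
theorem min_one_exp_neg_pos (x : ℝ) : 0 < min 1 (Real.exp (-x)) :=
  lt_min one_pos (Real.exp_pos _)

/-- The Metropolis density `min(1, e^{−x})` and `max(1, eˣ)` are pointwise inverse to each other.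
[folklore] -/
theorem min_one_exp_neg_mul_max_one_exp (x : ℝ) :
    min 1 (Real.exp (-x)) * max 1 (Real.exp x) = 1 := by
  rcases le_total 0 x with hx | hx
  · rw [min_eq_right (Real.exp_le_one_iff.2 (neg_nonpos.2 hx)),
      max_eq_right (Real.one_le_exp_iff.2 hx), ← Real.exp_add, neg_add_cancel, Real.exp_zero]
  · rw [min_eq_left (Real.one_le_exp_iff.2 (neg_nonneg.2 hx)),
      max_eq_left (Real.exp_le_one_iff.2 hx), one_mul]

/-- The symmetrised integrand `φ(x) = x · (max(1, eˣ) − max(1, e^{−x}))` is nonnegative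
(it equals `|x| · (e^{|x|} − 1)`). [folklore] -/
theorem phi_nonneg (x : ℝ) : 0 ≤ x * (max 1 (Real.exp x) - max 1 (Real.exp (-x))) := by
  rcases le_total 0 x with hx | hx
  · rw [max_eq_right (Real.one_le_exp_iff.2 hx),
      max_eq_left (Real.exp_le_one_iff.2 (neg_nonpos.2 hx))]
    exact mul_nonneg hx (sub_nonneg.2 (Real.one_le_exp_iff.2 hx))
  · rw [max_eq_left (Real.exp_le_one_iff.2 hx),
      max_eq_right (Real.one_le_exp_iff.2 (neg_nonneg.2 hx))]
    exact mul_nonneg_of_nonpos_of_nonpos hx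
      (sub_nonpos.2 (Real.one_le_exp_iff.2 (neg_nonneg.2 hx)))

/-- The symmetrised integrand `φ(x) = x · (max(1, eˣ) − max(1, e^{−x}))` vanishes only at `x = 0`.
[folklore] -/
theorem phi_eq_zero_iff (x : ℝ) : x * (max 1 (Real.exp x) - max 1 (Real.exp (-x))) = 0 ↔ x = 0 := by
  refine ⟨fun h => ?_, fun h => by rw [h, zero_mul]⟩
  rcases mul_eq_zero.1 h with h0 | h0
  · exact h0
  · by_contra hx
    rcases lt_or_gt_of_ne hx with hlt | hgt
    · rw [max_eq_left (Real.exp_le_one_iff.2 hlt.le),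
        max_eq_right (Real.one_le_exp_iff.2 (neg_nonneg.2 hlt.le))] at h0
      have : (1 : ℝ) < Real.exp (-x) := Real.one_lt_exp_iff.2 (neg_pos.2 hlt)
      linarith
    · rw [max_eq_right (Real.one_le_exp_iff.2 hgt.le),
        max_eq_left (Real.exp_le_one_iff.2 (neg_nonpos.2 hgt.le))] at h0
      have : (1 : ℝ) < Real.exp x := Real.one_lt_exp_iff.2 hgt
      linarith

/-! ## §2 The measure-theoretic core on an abstract measurable space -/

/-- **Detailed balance from `J`-symmetry of the Metropolis-reweighted measure (abstract core).**
On a measurable space, let `κ` be a measure, `F` measurable and real, `J` measurable with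
`F ∘ J = −F`, and suppose the reweighted measure `ν = min(1, e^{−F}) · κ` satisfies `ν.map J = ν`.
If `F` is `κ`-integrable with `∫ F dκ = 0`, then `F = 0` `κ`-a.e.: writing `κ = max(1, e^{F}) · ν`,
`0 = 2 ∫ F dκ = ∫ |F| (e^{|F|} − 1) dν`. [folklore] -/
theorem ae_eq_zero_of_odd_of_map_withDensity_eq {α : Type*} [MeasurableSpace α]
    (κ : Measure α) (F : α → ℝ) (J : α → α) (hJ : Measurable J) (hF : Measurable F)
    (hodd : ∀ q, F (J q) = -F q)
    (hinv : (κ.withDensity (fun q => ENNReal.ofReal (min 1 (Real.exp (-F q))))).map J =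
      κ.withDensity (fun q => ENNReal.ofReal (min 1 (Real.exp (-F q)))))
    (hint : Integrable F κ) (hbal : ∫ q, F q ∂κ = 0) : ∀ᵐ q ∂κ, F q = 0 := by
  -- the Metropolis density `d`, its inverse `m`, the reweighted measure `ν`
  set ν : Measure α := κ.withDensity (fun q => ENNReal.ofReal (min 1 (Real.exp (-F q)))) with hν
  have hd_meas : Measurable (fun q => ENNReal.ofReal (min 1 (Real.exp (-F q)))) :=
    (measurable_const.min (Real.measurable_exp.comp hF.neg)).ennreal_ofReal
  have hm_meas : Measurable (fun q => ENNReal.ofReal (max 1 (Real.exp (F q)))) :=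
    (measurable_const.max (Real.measurable_exp.comp hF)).ennreal_ofReal
  -- (1) `κ = m · ν`
  have hκ : ν.withDensity (fun q => ENNReal.ofReal (max 1 (Real.exp (F q)))) = κ := by
    rw [hν, ← withDensity_mul κ hd_meas hm_meas]
    conv_rhs => rw [← withDensity_one (μ := κ)]
    congr 1
    funext q
    rw [Pi.mul_apply, Pi.one_apply, ← ENNReal.ofReal_mul (min_one_exp_neg_pos (F q)).le,
      min_one_exp_neg_mul_max_one_exp, ENNReal.ofReal_one]
  have hκν : κ ≪ ν := by
    have h := withDensity_absolutelyContinuous ν (fun q => ENNReal.ofReal (max 1 (Real.exp (F q))))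
    rwa [hκ] at h
  -- (2) `∫ F dκ = ∫ m F dν`, with `m F` integrable w.r.t. `ν`
  have hm_lt : ∀ᵐ q ∂ν, (fun q => ENNReal.ofReal (max 1 (Real.exp (F q)))) q < ∞ :=
    Filter.Eventually.of_forall fun q => ENNReal.ofReal_lt_top
  have hG_int : Integrable (fun q => max 1 (Real.exp (F q)) * F q) ν := by
    have h := hint
    rw [← hκ, integrable_withDensity_iff_integrable_smul' hm_meas hm_lt] at h
    refine h.congr (Filter.Eventually.of_forall fun q => ?_)
    simp only [smul_eq_mul]
    rw [ENNReal.toReal_ofReal (zero_le_one.trans (le_max_left _ _))]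
  have h1 : ∫ q, F q ∂κ = ∫ q, max 1 (Real.exp (F q)) * F q ∂ν := by
    conv_lhs => rw [← hκ]
    rw [integral_withDensity_eq_integral_toReal_smul hm_meas hm_lt]
    refine integral_congr_ae (Filter.Eventually.of_forall fun q => ?_)
    simp only [smul_eq_mul]
    rw [ENNReal.toReal_ofReal (zero_le_one.trans (le_max_left _ _))]
  -- (3) `J`-invariance: `∫ m F dν = ∫ (m F) ∘ J dν = -∫ max(1, e^{-F}) F dν`
  have hG_meas : Measurable (fun q => max 1 (Real.exp (F q)) * F q) :=
    (measurable_const.max (Real.measurable_exp.comp hF)).mul hF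
  have h2 : ∫ q, max 1 (Real.exp (F q)) * F q ∂ν =
      ∫ q, max 1 (Real.exp (F (J q))) * F (J q) ∂ν := by
    conv_lhs => rw [← hinv]
    exact integral_map hJ.aemeasurable hG_meas.aestronglyMeasurable
  have hGJ_int : Integrable (fun q => max 1 (Real.exp (F (J q))) * F (J q)) ν := by
    have h := hG_int
    rw [← hinv] at h
    exact h.comp_measurable hJ
  -- the symmetrised integrand `φ(F) = m F + (m F) ∘ J`
  have hphi_int : Integrable
      (fun q => F q * (max 1 (Real.exp (F q)) - max 1 (Real.exp (-F q)))) ν := by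
    refine (hG_int.add hGJ_int).congr (Filter.Eventually.of_forall fun q => ?_)
    simp only [Pi.add_apply, hodd]
    ring
  have hsum : ∫ q, F q * (max 1 (Real.exp (F q)) - max 1 (Real.exp (-F q))) ∂ν = 0 := by
    have h : ∫ q, F q * (max 1 (Real.exp (F q)) - max 1 (Real.exp (-F q))) ∂ν =
        ∫ q, max 1 (Real.exp (F q)) * F q ∂ν +
          ∫ q, max 1 (Real.exp (F (J q))) * F (J q) ∂ν := by
      rw [← integral_add hG_int hGJ_int]
      refine integral_congr_ae (Filter.Eventually.of_forall fun q => ?_)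
      simp only [hodd]
      ring
    rw [h, ← h2, ← h1, hbal, add_zero]
  -- (4) `φ(F) ≥ 0` with zero integral, so `φ(F) = 0` `ν`-a.e., so `F = 0` `ν`-a.e. and `κ`-a.e.
  have hae : ∀ᵐ q ∂ν, F q * (max 1 (Real.exp (F q)) - max 1 (Real.exp (-F q))) = 0 :=
    (integral_eq_zero_iff_of_nonneg (fun q => phi_nonneg (F q)) hphi_int).1 hsum
  exact hκν.ae_le (hae.mono fun q hq => (phi_eq_zero_iff (F q)).1 hq)

/-! ## §3 The inverse-collision map and the stub -/

/-- The inverse-collision map `J (p, ω) = (collide ω p, −ω)` on `(V3 × V3) × S²` is continuous.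
[folklore] -/
theorem continuous_inverseCollision :
    Continuous (fun q : (V3 × V3) × Metric.sphere (0 : V3) 1 => (collide q.2 q.1, -q.2)) := by
  unfold collide
  fun_prop

/-- The inverse-collision map `J (p, ω) = (collide ω p, −ω)` on `(V3 × V3) × S²` is measurable.
[folklore] -/
theorem measurable_inverseCollision :
    Measurable (fun q : (V3 × V3) × Metric.sphere (0 : V3) 1 => (collide q.2 q.1, -q.2)) :=
  continuous_inverseCollision.measurable

/-- **STUB `stub_detailedBalanceOfSymmetricRecord` (line `Sketch`, crux `ParityBandClosure`,
stmt-17608): detailed balance of a `J`-symmetric Metropolis-reweighted collision record.** For a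
finite measure `κ` on `(V3 × V3) × S²`, a measurable `F` that is odd under the inverse collision
`J q = (collide q.2 q.1, −q.2)` and whose Metropolis reweighting `min(1, e^{−F}) · κ` is
`J`-invariant, `κ`-integrable with `∫ F dκ = 0`, and any `π ≪ κ`: `F = 0` `π`-a.e.
(`ae_eq_zero_of_odd_of_map_withDensity_eq` + `measurable_inverseCollision` + `π ≪ κ`).
[folklore] -/
theorem stub_detailedBalanceOfSymmetricRecord : ∀ (κ π : Measure ((V3 × V3) × Metric.sphere (0 : V3) 1)) (F : (V3 × V3) × Metric.sphere (0 : V3) 1 → ℝ), IsFiniteMeasure κ → Measurable F → (let J : (V3 × V3) × Metric.sphere (0 : V3) 1 → (V3 × V3) × Metric.sphere (0 : V3) 1 := fun q => (collide q.2 q.1, -q.2); (∀ q, F (J q) = -F q) ∧ (κ.withDensity (fun q => ENNReal.ofReal (min 1 (Real.exp (-F q))))).map J = κ.withDensity (fun q => ENNReal.ofReal (min 1 (Real.exp (-F q))))) → Integrable F κ → ∫ q, F q ∂κ = 0 → π ≪ κ → ∀ᵐ q ∂π, F q = 0 := by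
  intro κ π F _ hF hJ hint hbal hπ
  obtain ⟨hodd, hinv⟩ := hJ
  exact hπ.ae_le (ae_eq_zero_of_odd_of_map_withDensity_eq κ F _ measurable_inverseCollision hF
    hodd hinv hint hbal)

end Summit.AtomisticToContinuum.HydrodynamicLimit.Theorems.ParityBandClosureDetailedBalance

end
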